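import Mathlib
import Summits.QuantumFields.QCD.Theorems.WilsonQuarkChessboardBackgroundSchwarzBlock

/-!
# Abstract background Schwarz inequality: removing the invertibility of the interiors

`schwarz_assemble_of_isUnit` (file `…BackgroundSchwarzBlock`) proves the block-matrix Schwarz
inequality when the interior blocks `A, A°` are invertible.  Here the assumption is removed by the
mass perturbation `𝕄 ↦ 𝕄 + t·1`, `t → 0⁺`: the shifted matrix is again a block assembly (with
`A + t, A° + t, 𝔅ᵢ + t`), its interiors are invertible for all but finitely many `t`
(`-t ∉ spectrum`), the weights stay positive definite for `t > 0`, and all conclusions are closed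
conditions in `t`.
-/

namespace Summit.QuantumFields.QCD.Theorems.BackgroundSchwarz

open Matrix Filter Topology
open scoped ComplexOrder MatrixOrder ComplexConjugate

variable {ι β₁ β₂ : Type*} [Fintype ι] [Fintype β₁] [Fintype β₂]
  [DecidableEq ι] [DecidableEq β₁] [DecidableEq β₂]

variable (Sg : Matrix ι ι ℂ) (B₁ : Matrix β₁ β₁ ℂ) (B₂ : Matrix β₂ β₂ ℂ)
  (A : Matrix ι ι ℂ) (Aib : Matrix ι β₁ ℂ) (Abi : Matrix β₂ ι ℂ) (Abb : Matrix β₂ β₁ ℂ)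
  (A' : Matrix ι ι ℂ) (Aib' : Matrix ι β₁ ℂ) (Abi' : Matrix β₂ ι ℂ) (Abb' : Matrix β₂ β₁ ℂ)

omit [Fintype β₁] [Fintype β₂] in
/-- The mass shift of a block assembly is the block assembly of the shifted diagonal blocks. -/
theorem assemble_add_smul_one (hSg : Sg * Sg = 1) (t : ℝ) :
    (fromBlocks (fromBlocks A 0 0 (Sg * A'ᴴ * Sg)) (fromBlocks Aib 0 0 (Sg * Abi'ᴴ)) (fromBlocks 0 (-(Aib'ᴴ * Sg)) Abi 0) (fromBlocks B₁ (-Abb'ᴴ) Abb B₂)) +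
        (t : ℂ) • (1 : Matrix ((ι ⊕ ι) ⊕ (β₁ ⊕ β₂)) ((ι ⊕ ι) ⊕ (β₁ ⊕ β₂)) ℂ) =
      (fromBlocks (fromBlocks (A + (t : ℂ) • (1 : Matrix ι ι ℂ)) 0 0 (Sg * (A' + (t : ℂ) • (1 : Matrix ι ι ℂ))ᴴ * Sg)) (fromBlocks Aib 0 0 (Sg * Abi'ᴴ)) (fromBlocks 0 (-(Aib'ᴴ * Sg)) Abi 0) (fromBlocks (B₁ + (t : ℂ) • (1 : Matrix β₁ β₁ ℂ)) (-Abb'ᴴ) Abb (B₂ + (t : ℂ) • (1 : Matrix β₂ β₂ ℂ)))) := by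
  have hN : Sg * (A' + (t : ℂ) • (1 : Matrix ι ι ℂ))ᴴ * Sg = Sg * A'ᴴ * Sg + (t : ℂ) • 1 := by
    rw [conjTranspose_add, conjTranspose_smul, conjTranspose_one, Complex.star_def,
      Complex.conj_ofReal, Matrix.mul_add, Matrix.add_mul, Matrix.mul_smul, Matrix.mul_one,
      Matrix.smul_mul, hSg]
  rw [hN, ← fromBlocks_one, ← fromBlocks_one, ← fromBlocks_one, fromBlocks_smul, fromBlocks_smul,
    fromBlocks_smul, fromBlocks_add, fromBlocks_add, fromBlocks_add]
  simp only [smul_zero, add_zero]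

/-- `det (M + t·1) = 0` only for `-t` in the (finite) real spectrum of `M`. -/
theorem finite_setOf_det_add_smul_one_eq_zero (M : Matrix ι ι ℂ) :
    {t : ℝ | (M + (t : ℂ) • (1 : Matrix ι ι ℂ)).det = 0}.Finite := by
  refine (M.finite_real_spectrum.preimage (neg_injective.injOn)).subset fun t ht => ?_
  simp only [Set.mem_preimage, Set.mem_setOf_eq] at ht ⊢
  rw [spectrum.mem_iff]
  intro hu
  have h1 : algebraMap ℝ (Matrix ι ι ℂ) (-t) - M = -(M + (t : ℂ) • (1 : Matrix ι ι ℂ)) := by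
    rw [Algebra.algebraMap_eq_smul_one, neg_add, ← sub_eq_neg_add]
    congr 1
    ext i j
    simp [Matrix.smul_apply, Complex.real_smul]
  rw [h1, IsUnit.neg_iff, isUnit_iff_isUnit_det, ht] at hu
  exact not_isUnit_zero hu

/-- `t ↦ det (M + t·1)` is continuous. -/
theorem continuous_det_add_smul_one {κ : Type*} [Fintype κ] [DecidableEq κ] (M : Matrix κ κ ℂ) :
    Continuous fun t : ℝ => (M + (t : ℂ) • (1 : Matrix κ κ ℂ)).det :=
  (continuous_const.add (Complex.continuous_ofReal.smul continuous_const)).matrix_det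

/-- A positive definite matrix stays positive definite under a non-negative mass shift. -/
theorem posDef_add_smul_one {κ : Type*} [Fintype κ] [DecidableEq κ] {M : Matrix κ κ ℂ}
    (hM : M.PosDef) {t : ℝ} (ht : 0 ≤ t) : (M + (t : ℂ) • (1 : Matrix κ κ ℂ)).PosDef :=
  hM.add_posSemidef (PosSemidef.one.smul (by exact_mod_cast ht))

/-- **Abstract background Schwarz inequality** (no invertibility assumption).  For `Σ² = 1` and
`𝔅₁, 𝔅₂` positive definite: `det 𝕄(P;P)`, `det 𝕄(Q;Q)` are real, non-negative, and
`‖det 𝕄(P;Q)‖² ≤ Re det 𝕄(P;P) · Re det 𝕄(Q;Q)`. -/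
theorem schwarz_assemble (hSg : Sg * Sg = 1) (hB₁ : B₁.PosDef) (hB₂ : B₂.PosDef) :
    0 ≤ (((fromBlocks (fromBlocks A 0 0 (Sg * Aᴴ * Sg)) (fromBlocks Aib 0 0 (Sg * Abiᴴ)) (fromBlocks 0 (-(Aibᴴ * Sg)) Abi 0) (fromBlocks B₁ (-Abbᴴ) Abb B₂))).det).re ∧
    (((fromBlocks (fromBlocks A 0 0 (Sg * Aᴴ * Sg)) (fromBlocks Aib 0 0 (Sg * Abiᴴ)) (fromBlocks 0 (-(Aibᴴ * Sg)) Abi 0) (fromBlocks B₁ (-Abbᴴ) Abb B₂))).det).im = 0 ∧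
    0 ≤ (((fromBlocks (fromBlocks A' 0 0 (Sg * A'ᴴ * Sg)) (fromBlocks Aib' 0 0 (Sg * Abi'ᴴ)) (fromBlocks 0 (-(Aib'ᴴ * Sg)) Abi' 0) (fromBlocks B₁ (-Abb'ᴴ) Abb' B₂))).det).re ∧
    (((fromBlocks (fromBlocks A' 0 0 (Sg * A'ᴴ * Sg)) (fromBlocks Aib' 0 0 (Sg * Abi'ᴴ)) (fromBlocks 0 (-(Aib'ᴴ * Sg)) Abi' 0) (fromBlocks B₁ (-Abb'ᴴ) Abb' B₂))).det).im = 0 ∧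
    ‖((fromBlocks (fromBlocks A 0 0 (Sg * A'ᴴ * Sg)) (fromBlocks Aib 0 0 (Sg * Abi'ᴴ)) (fromBlocks 0 (-(Aib'ᴴ * Sg)) Abi 0) (fromBlocks B₁ (-Abb'ᴴ) Abb B₂))).det‖ ^ 2 ≤
      (((fromBlocks (fromBlocks A 0 0 (Sg * Aᴴ * Sg)) (fromBlocks Aib 0 0 (Sg * Abiᴴ)) (fromBlocks 0 (-(Aibᴴ * Sg)) Abi 0) (fromBlocks B₁ (-Abbᴴ) Abb B₂))).det).re *
        (((fromBlocks (fromBlocks A' 0 0 (Sg * A'ᴴ * Sg)) (fromBlocks Aib' 0 0 (Sg * Abi'ᴴ)) (fromBlocks 0 (-(Aib'ᴴ * Sg)) Abi' 0) (fromBlocks B₁ (-Abb'ᴴ) Abb' B₂))).det).re := by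
  -- the three matrices and their mass shifts
  set MPQ := (fromBlocks (fromBlocks A 0 0 (Sg * A'ᴴ * Sg)) (fromBlocks Aib 0 0 (Sg * Abi'ᴴ)) (fromBlocks 0 (-(Aib'ᴴ * Sg)) Abi 0) (fromBlocks B₁ (-Abb'ᴴ) Abb B₂)) with hMPQ
  set MPP := (fromBlocks (fromBlocks A 0 0 (Sg * Aᴴ * Sg)) (fromBlocks Aib 0 0 (Sg * Abiᴴ)) (fromBlocks 0 (-(Aibᴴ * Sg)) Abi 0) (fromBlocks B₁ (-Abbᴴ) Abb B₂)) with hMPP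
  set MQQ := (fromBlocks (fromBlocks A' 0 0 (Sg * A'ᴴ * Sg)) (fromBlocks Aib' 0 0 (Sg * Abi'ᴴ)) (fromBlocks 0 (-(Aib'ᴴ * Sg)) Abi' 0) (fromBlocks B₁ (-Abb'ᴴ) Abb' B₂)) with hMQQ
  set fPQ : ℝ → ℂ := fun t => (MPQ + (t : ℂ) • (1 : Matrix _ _ ℂ)).det with hfPQ
  set fPP : ℝ → ℂ := fun t => (MPP + (t : ℂ) • (1 : Matrix _ _ ℂ)).det with hfPP
  set fQQ : ℝ → ℂ := fun t => (MQQ + (t : ℂ) • (1 : Matrix _ _ ℂ)).det with hfQQ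
  have cPQ : Continuous fPQ := continuous_det_add_smul_one MPQ
  have cPP : Continuous fPP := continuous_det_add_smul_one MPP
  have cQQ : Continuous fQQ := continuous_det_add_smul_one MQQ
  have f0 : fPQ 0 = MPQ.det ∧ fPP 0 = MPP.det ∧ fQQ 0 = MQQ.det := by
    simp [hfPQ, hfPP, hfQQ]
  -- the good parameters: `t > 0`, `A + t`, `A' + t` invertible — eventually in `𝓝[>] 0`
  set F : Set ℝ := {t | (A + (t : ℂ) • (1 : Matrix ι ι ℂ)).det = 0} ∪
    {t | (A' + (t : ℂ) • (1 : Matrix ι ι ℂ)).det = 0} with hF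
  have hFfin : F.Finite :=
    (finite_setOf_det_add_smul_one_eq_zero A).union (finite_setOf_det_add_smul_one_eq_zero A')
  have hev : ∀ᶠ t in 𝓝[>] (0 : ℝ), 0 < t ∧ t ∉ F := by
    refine (eventually_mem_nhdsWithin).and ?_
    have : ∀ s ∈ F, ∀ᶠ t in 𝓝[>] (0 : ℝ), t ≠ s := by
      intro s _
      by_cases hs : s = 0
      · exact eventually_mem_nhdsWithin.mono fun t ht => by rw [hs]; exact ne_of_gt ht
      · exact (eventually_ne_nhds (Ne.symm hs)).filter_mono nhdsWithin_le_nhds |>.mono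
          fun t ht => ht
    have hall := (hFfin.eventually_all).2 this
    exact hall.mono fun t ht htF => ht t htF rfl
  have hgood : ∀ᶠ t in 𝓝[>] (0 : ℝ), (0 : ℂ) ≤ fPP t ∧ (0 : ℂ) ≤ fQQ t ∧
      ((‖fPQ t‖ ^ 2 : ℝ) : ℂ) ≤ fPP t * fQQ t := by
    refine hev.mono fun t ⟨ht, htF⟩ => ?_
    simp only [hF, Set.mem_union, Set.mem_setOf_eq, not_or] at htF
    have h := schwarz_assemble_of_isUnit Sg (B₁ + (t : ℂ) • 1) (B₂ + (t : ℂ) • 1)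
      (A + (t : ℂ) • 1) Aib Abi Abb (A' + (t : ℂ) • 1) Aib' Abi' Abb' hSg
      (posDef_add_smul_one hB₁ ht.le) (posDef_add_smul_one hB₂ ht.le)
      (isUnit_iff_ne_zero.2 htF.1) (isUnit_iff_ne_zero.2 htF.2)
    simp only [hfPQ, hfPP, hfQQ, hMPQ, hMPP, hMQQ, assemble_add_smul_one _ _ _ _ _ _ _ _ _ _ _ hSg]
    exact h
  -- pass to the limit `t → 0⁺` in real and imaginary parts
  have tPQ : Tendsto fPQ (𝓝[>] 0) (𝓝 (fPQ 0)) := cPQ.continuousAt.continuousWithinAt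
  have tPP : Tendsto fPP (𝓝[>] 0) (𝓝 (fPP 0)) := cPP.continuousAt.continuousWithinAt
  have tQQ : Tendsto fQQ (𝓝[>] 0) (𝓝 (fQQ 0)) := cQQ.continuousAt.continuousWithinAt
  have limPP : (0 : ℂ) ≤ fPP 0 := by
    refine ⟨?_, ?_⟩
    · exact ge_of_tendsto (Complex.continuous_re.continuousAt.tendsto.comp tPP)
        (hgood.mono fun t ht => (Complex.le_def.1 ht.1).1)
    · exact tendsto_nhds_unique_of_eventuallyEq
        (tendsto_const_nhds) (Complex.continuous_im.continuousAt.tendsto.comp tPP)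
        (hgood.mono fun t ht => (Complex.le_def.1 ht.1).2)
  have limQQ : (0 : ℂ) ≤ fQQ 0 := by
    refine ⟨?_, ?_⟩
    · exact ge_of_tendsto (Complex.continuous_re.continuousAt.tendsto.comp tQQ)
        (hgood.mono fun t ht => (Complex.le_def.1 ht.2.1).1)
    · exact tendsto_nhds_unique_of_eventuallyEq
        (tendsto_const_nhds) (Complex.continuous_im.continuousAt.tendsto.comp tQQ)
        (hgood.mono fun t ht => (Complex.le_def.1 ht.2.1).2)
  have limPQ : ‖fPQ 0‖ ^ 2 ≤ (fPP 0).re * (fQQ 0).re := by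
    have h1 : Tendsto (fun t => ‖fPQ t‖ ^ 2) (𝓝[>] 0) (𝓝 (‖fPQ 0‖ ^ 2)) :=
      ((continuous_norm.pow 2).continuousAt.tendsto.comp tPQ)
    have h2 : Tendsto (fun t => (fPP t * fQQ t).re) (𝓝[>] 0) (𝓝 ((fPP 0 * fQQ 0).re)) :=
      Complex.continuous_re.continuousAt.tendsto.comp (tPP.mul tQQ)
    have h3 := le_of_tendsto_of_tendsto h1 h2 (hgood.mono fun t ht => by
      have := (Complex.le_def.1 ht.2.2).1
      rwa [Complex.ofReal_re] at this)
    have him : (fPP 0).im = 0 := by simpa using limPP.2.symm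
    have him' : (fQQ 0).im = 0 := by simpa using limQQ.2.symm
    simpa [Complex.mul_re, him, him'] using h3
  rw [f0.1, f0.2.1, f0.2.2] at *
  refine ⟨(Complex.le_def.1 limPP).1, ?_, (Complex.le_def.1 limQQ).1, ?_, limPQ⟩
  · simpa using (Complex.le_def.1 limPP).2.symm
  · simpa using (Complex.le_def.1 limQQ).2.symm

end Summit.QuantumFields.QCD.Theorems.BackgroundSchwarz
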